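import Summits.AtomisticToContinuum.BoseEinsteinCondensation.Theorems.GaussianDominationCan.Negative.CruxForms

/-!
# Crux `GaussianDominationCan` — tightness of the constant: `C ≥ 1/(4π²)` already for the free gas

Crux disprover result for `stmt-AtomisticToContinuum-9479` (route BECThomsonPrinciple):
`free_const_ge` — if the crux inequality holds for `v = 0` with constant `C` (any `ρ₀, N₀`, window
`M`) then `C ≥ 1/(4π²)`; `not_gaussianDominationCan_sharp` — the crux with the extra demand
`C < 1/(4π²)` is false.  Witness: coherent two-mode product states `((α + β e_{e₀})/√L³)^{⊗N}` at
the top corner `L = M²N/4π²`, `β² = δ/4N`, Bernoulli's inequality.  [folklore]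
-/

noncomputable section

namespace Summit.AtomisticToContinuum.BoseEinsteinCondensation.Theorems.GaussianDominationCan.Negative

open MeasureTheory Literature.MathematicalPhysics.QuantumManyBody.BoseGas
open scoped ENNReal NNReal ComplexConjugate

variable {N : ℕ} {L : ℝ}

/-! ## §B Tightness: the constant cannot go below the free value `1/(4π²)` -/

section Tightness

/-- **`C ≥ 1/(4π²)` is forced by the free gas.** If the crux inequality holds for `v = 0` with
constant `C` (at some `ρ₀, N₀`, window `M`), then `C ≥ 1/(4π²)`: the coherent two-mode product
states `((α + β e_{e₀})/√L³)^{⊗N}`, `β → 0`, at the top corner of the window have susceptibility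
ratio `→ L²/(4π²)`. (Bernoulli's inequality controls `α^{4N-2}`.) -/
theorem free_const_ge {ρ₀ M C : ℝ} {N₀ : ℕ} (hρ : 0 < ρ₀) (hM : 0 < M)
    (h : GDCanWith ρ₀ C N₀ 0 M) : 1 / (4 * Real.pi ^ 2) ≤ C := by
  by_contra hC
  rw [not_le] at hC
  set C' : ℝ := max C (1 / (8 * Real.pi ^ 2)) with hC'def
  have hC'pos : 0 < C' := lt_max_of_lt_right (by positivity)
  have h8 : 1 / (8 * Real.pi ^ 2) < 1 / (4 * Real.pi ^ 2) :=
    one_div_lt_one_div_of_lt (by positivity) (by nlinarith [Real.pi_pos])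
  have hC'lt : C' < 1 / (4 * Real.pi ^ 2) := max_lt hC h8
  have h' : GDCanWith ρ₀ C' N₀ 0 M := h.mono_C (le_max_left _ _)
  set δ : ℝ := 1 - 4 * Real.pi ^ 2 * C' with hδdef
  have hδ : 0 < δ := by
    rw [hδdef, sub_pos, ← lt_div_iff₀' (by positivity)]
    exact hC'lt
  have hδ1 : δ ≤ 1 := by rw [hδdef]; nlinarith [Real.pi_pos, hC'pos]
  -- choice of N, L
  obtain ⟨m, hmN₀, hKN⟩ := exists_large N₀ (64 * Real.pi ^ 6 / (ρ₀ * M ^ 6))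
  set N : ℝ := ((m + 1 : ℕ) : ℝ) with hNdef
  have hN1 : (1 : ℝ) ≤ N := by rw [hNdef]; exact_mod_cast Nat.succ_le_succ (Nat.zero_le m)
  have hNpos : 0 < N := by linarith
  obtain ⟨hL, hdens, hwin⟩ := corner hM hρ m hKN
  set L : ℝ := M ^ 2 * N / (4 * Real.pi ^ 2) with hLdef
  -- amplitudes: B = b²L³ = δ/(4N), A = a²L³ = 1 - B
  set B : ℝ := δ / (4 * N) with hBdef
  set A : ℝ := 1 - B with hAdef
  have hB : 0 < B := by positivity
  have hB1 : B ≤ 1 / 4 := by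
    rw [hBdef, div_le_div_iff₀ (by positivity) (by positivity)]; nlinarith
  have hA : 0 < A := by rw [hAdef]; linarith
  set a : ℝ := Real.sqrt (A / L ^ 3) with hadef
  set b : ℝ := Real.sqrt (B / L ^ 3) with hbdef
  have ha : 0 ≤ a := Real.sqrt_nonneg _
  have hb : 0 ≤ b := Real.sqrt_nonneg _
  have ha2 : a ^ 2 * L ^ 3 = A := by
    rw [hadef, Real.sq_sqrt (by positivity), div_mul_cancel₀ _ (by positivity)]
  have hb2 : b ^ 2 * L ^ 3 = B := by
    rw [hbdef, Real.sq_sqrt (by positivity), div_mul_cancel₀ _ (by positivity)]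
  have hab : (a ^ 2 + b ^ 2) * L ^ 3 = 1 := by rw [add_mul, ha2, hb2, hAdef]; ring
  have hN' : (m : ℝ) + 1 = N := by rw [hNdef]; push_cast; ring
  -- the source lower bound and the energy
  have hsrc := norm_sourceIntegral_symFun_ge (m := m) hL e0_ne_zero ha hb
  rw [show L ^ 3 * a ^ 2 = A by rw [← ha2]; ring, hN'] at hsrc
  set P : ℝ := L ^ 3 * a * b with hPdef
  have hP2 : P ^ 2 = A * B := by
    calc P ^ 2 = (a ^ 2 * L ^ 3) * (b ^ 2 * L ^ 3) := by rw [hPdef]; ring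
      _ = A * B := by rw [ha2, hb2]
  have hP : 0 ≤ P := by positivity
  set u : ℝ := N * ((Real.sqrt N)⁻¹ * P * A ^ m) with hudef
  have hu : 0 ≤ u := by positivity
  have hu2 : u ^ 2 = N * (A * B) * A ^ (2 * m) := by
    have h1 : (Real.sqrt N)⁻¹ ^ 2 = N⁻¹ := by rw [inv_pow, Real.sq_sqrt hNpos.le]
    calc u ^ 2 = N ^ 2 * (Real.sqrt N)⁻¹ ^ 2 * P ^ 2 * (A ^ m) ^ 2 := by rw [hudef]; ring
      _ = N ^ 2 * N⁻¹ * (A * B) * A ^ (2 * m) := by rw [h1, hP2, ← pow_mul, mul_comm m 2]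
      _ = N * (A * B) * A ^ (2 * m) := by field_simp
  set s : ℝ := u / (C' * L ^ 2) with hsdef
  have hs : 0 ≤ s := by positivity
  have key := h' m hmN₀ L hL hdens e0 e0_ne_zero hwin s hs (symState m hL e0_ne_zero a b hab)
  have hE := periodicEnergy_symState (m := m) hL e0_ne_zero hab
  rw [nsq_e0, hb2] at hE
  have hEnn : 0 ≤ N * (B * (4 * Real.pi ^ 2 * 1 / L ^ 2)) := by positivity
  have hreal := real_of_gdIneq hEnn hE (by rw [norm_e0]; positivity) key
  rw [norm_e0, one_pow, div_one, hN'] at hreal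
  -- lower bound of the left-hand side by `s · 2u`
  have hI : u ≤ N * ‖sourceIntegral m L e0 (symFun m L e0 a b)‖ := by
    rw [hudef]
    exact mul_le_mul_of_nonneg_left hsrc hNpos.le
  have h2 : s * (2 * u) ≤ N * (B * (4 * Real.pi ^ 2 * 1 / L ^ 2)) + C' * s ^ 2 * L ^ 2 := by
    refine le_trans ?_ hreal
    have : 2 * u ≤ 2 * N * ‖sourceIntegral m L e0 (symState m hL e0_ne_zero a b hab).ψ‖ := by
      show 2 * u ≤ 2 * N * ‖sourceIntegral m L e0 (symFun m L e0 a b)‖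
      linarith
    exact mul_le_mul_of_nonneg_left this hs
  -- substitute `s = u/(C'L²)`
  have e1 : s * (2 * u) = 2 * (u ^ 2 / (C' * L ^ 2)) := by
    rw [hsdef]
    field_simp
  have e2 : C' * s ^ 2 * L ^ 2 = u ^ 2 / (C' * L ^ 2) := by
    rw [hsdef]
    field_simp
  rw [e1, e2] at h2
  have h3 : u ^ 2 / (C' * L ^ 2) ≤ N * (B * (4 * Real.pi ^ 2 * 1 / L ^ 2)) := by linarith
  rw [div_le_iff₀ (by positivity)] at h3
  have h4 : u ^ 2 ≤ 4 * Real.pi ^ 2 * C' * (N * B) := by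
    calc u ^ 2 ≤ N * (B * (4 * Real.pi ^ 2 * 1 / L ^ 2)) * (C' * L ^ 2) := h3
      _ = 4 * Real.pi ^ 2 * C' * (N * B) := by field_simp
  rw [hu2] at h4
  have h5 : A ^ (2 * m + 1) ≤ 4 * Real.pi ^ 2 * C' := by
    have hNB : 0 < N * B := by positivity
    have : N * B * A ^ (2 * m + 1) ≤ N * B * (4 * Real.pi ^ 2 * C') := by
      calc N * B * A ^ (2 * m + 1) = N * (A * B) * A ^ (2 * m) := by ring
        _ ≤ 4 * Real.pi ^ 2 * C' * (N * B) := h4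
        _ = N * B * (4 * Real.pi ^ 2 * C') := by ring
    exact le_of_mul_le_mul_left this hNB
  -- Bernoulli: `A^(2m+1) = (1-B)^(2m+1) ≥ 1 - (2m+1)B > 1 - δ = 4π²C'`
  have hbern : 1 - ((2 * m + 1 : ℕ) : ℝ) * B ≤ A ^ (2 * m + 1) := by
    have hh := one_add_mul_le_pow (show (-2 : ℝ) ≤ -B by linarith) (2 * m + 1)
    have e : (1 : ℝ) + -B = A := by rw [hAdef]; ring
    rw [e] at hh
    linarith [hh]
  have hsmall : ((2 * m + 1 : ℕ) : ℝ) * B < δ := by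
    rw [hBdef, ← mul_div_assoc, div_lt_iff₀ (by positivity)]
    have hlt : ((2 * m + 1 : ℕ) : ℝ) < 4 * N := by rw [hNdef]; push_cast; linarith
    calc ((2 * m + 1 : ℕ) : ℝ) * δ < 4 * N * δ := mul_lt_mul_of_pos_right hlt hδ
      _ = δ * (4 * N) := by ring
  have h6 : 4 * Real.pi ^ 2 * C' = 1 - δ := by rw [hδdef]; ring
  linarith [h5, hbern, hsmall, h6]

/-- Corollary: **the crux with the sharper demand `C < 1/(4π²)` is FALSE** (already for the
free gas), i.e. the order of the constant in the crux is saturated by `v = 0`. -/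
theorem not_gaussianDominationCan_sharp :
    ¬ (∀ v : ℝ → ℝ≥0∞, IsRepulsiveFiniteRange v → ∀ M : ℝ, 0 < M →
        ∃ ρ₀ C : ℝ, 0 < ρ₀ ∧ 0 < C ∧ C < 1 / (4 * Real.pi ^ 2) ∧
          ∃ N₀ : ℕ, GDCanWith ρ₀ C N₀ v M) := by
  intro h
  obtain ⟨ρ₀, C, hρ, _, hClt, N₀, hG⟩ := h 0 isRepulsiveFiniteRange_zero 1 one_pos
  exact absurd (free_const_ge hρ one_pos hG) (not_le.mpr hClt)

end Tightness

end Summit.AtomisticToContinuum.BoseEinsteinCondensation.Theorems.GaussianDominationCan.Negative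

end
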